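import Mathlib
import Literature.NumberTheory.Automorphic.BaseChangeCyclicCuspidal
import Literature.NumberTheory.Automorphic.AutomorphicTwistWeightOne
import Literature.NumberTheory.Automorphic.ReciprocityGLn
import Literature.NumberTheory.Automorphic.TunnellOctahedralGlobal
import Literature.NumberTheory.GaloisRepresentations.GaloisRep
import HarnessLib

/-!
# QuadraticBaseChangeFrobCompatible

Topic `Literature/NumberTheory/Automorphic`. Named literature fact(s) relocated by the gate from `Summits/Langlands/Langlands/Theorems/SkinnerWilesDefectOneEisensteinProModularSeedQuadraticBaseChangeTwist.lean`
(accept-time relocation of `[cite]`d propositions written inline in a Summits proposal; human ruling 2026-08-15).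
Sources: ArthurClozelAMS120, BuzzardGeeLMS2014, CarayolASENS1986, LanglandsBaseChange1980.

* `Literature.NumberTheory.Automorphic.Langlands1980_quadraticBaseChange_frobCompatible`
-/

namespace Literature.NumberTheory.Automorphic

open scoped MatrixGroups Matrix NumberField Polynomial Classical
open NumberField IsDedekindDomain Field Polynomial Filter
open Literature.NumberTheory.Automorphic Literature.NumberTheory.GaloisRepresentations

/-- **Langlands' base change of `GL₂` along a quadratic field is compatible with the Galois
representation at every place off `p`** (Langlands 1980, *Base change for GL(2)*: for a cyclic
extension of prime degree every cuspidal `π` has a base-change lift `Π` whose local component at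
EVERY place `w ∣ ℓ` is the local lifting of `π_ℓ` — recalled as 12.2.1 (b) in Carayol 1986;
Arthur–Clozel, Ch. 3, Thm. 4.2 (a) with Thm. 5.1 "if `Π` is a weak lifting of `π`, then `Π` is in
fact a strong lifting"; Carayol 1986, Thm. (A): for a cuspidal `π` on `GL₂(𝔸_ℚ)` of weight `k ≥ 2`
the attached `λ`-adic representation restricted to the decomposition group at EVERY `ℓ ∤ λ`
corresponds to `π_ℓ` under the Hecke/Langlands correspondence, and §12.2.2 with its Proposition:
for an extension of local fields of degree `≤ 3` the local lifting of `π_ℓ` corresponds to the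
restriction of its Weil–Deligne parameter).  CONSEQUENCE STATED (unramified form, the only local
condition the datum model expresses): let `F/ℚ` be quadratic, `π` cuspidal on `GL₂(𝔸_ℚ)` with a
regular L-algebraic infinity type, `ρ : Γ_ℚ → GL₂(ℚ̄_p)` continuous, irreducible and
Satake–Frobenius compatible with `π` at almost every place (Buzzard–Gee's unramified dictionary,
`arithFrobPolyOfSatake ι q 1`; so `ρ ≅ ρ_{π,ι}` by Chebotarev–Brauer–Nesbitt), and `Π` a CUSPIDAL
automorphic representation of `GL₂(𝔸_F)` which is a weak base-change lift of `π`
(`IsWeakBaseChangeLiftAE`; by strong multiplicity one `Π` is Langlands' lift).  Then at every finite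
place `w ∤ p` of `F` at which `ρ|_{Γ_F}` is unramified, `Π` is unramified with a Satake parameter
`α` and the arithmetic Frobenii of `ρ|_{Γ_F}` above `w` have characteristic polynomial
`arithFrobPolyOfSatake ι q_w 1 α` (`WD(ρ|_{Γ_{F_w}}) = WD(ρ|_{Γ_{ℚ_ℓ}})|_{W_{F_w}}` is the parameter
of `π_ℓ` restricted (Thm. (A)), i.e. of `BC(π_ℓ) = Π_w` (§12.2), and is unramified, so `Π_w` is the
unramified principal series with the matching Satake parameter).  At the places over the primes
where `π` is unramified this is the tree's a.e. bookkeeping (`IsWeakBaseChangeLiftAE`,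
`hasFrobCharpolyAt_restrictField_fin_two`); the content is at the finitely many `w` over ramified
primes of `π` where `ρ|_{Γ_F}` is nevertheless unramified.
-- TODO(general form): `E/F` cyclic of prime degree over totally real `F`, Hilbert cusp forms of
-- paritious weight `≥ 2` (Langlands 1980, Arthur–Clozel Thm. 5.1; Carayol (A) with its hypothesis
-- at one finite place when `[F:ℚ]` is even); degree `≤ 3` in Carayol's Prop. 12.2.2.
[cite: LanglandsBaseChange1980, global base change lifting with local lifting at every place]
[cite: ArthurClozelAMS120, Ch. 3 Thm. 4.2 (a) and Thm. 5.1]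
[cite: CarayolASENS1986, Thm. (A) and §12.2.1 (b) and §12.2.2 Proposition]
[cite: BuzzardGeeLMS2014, Conj. 3.2.1 and Rem. 3.2.5]
[file NumberTheory/Automorphic/QuadraticBaseChangeFrobCompatible] -/
def Langlands1980_quadraticBaseChange_frobCompatible : Prop :=
  ∀ (F : Type) [Field F] [NumberField F], Module.finrank ℚ F = 2 →
    ∀ (p : ℕ) [Fact p.Prime] (ι : PadicAlgCl p ≃+* ℂ)
      (hQ : Literature.NumberTheory.Automorphic.isCompact_glFiniteIntegralLevel 2 ℚ)
      (hF : Literature.NumberTheory.Automorphic.isCompact_glFiniteIntegralLevel 2 F)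
      (π : Literature.NumberTheory.Automorphic.CuspidalAutomorphicRepData 2 ℚ hQ)
      (T : Literature.NumberTheory.Automorphic.InfinityType ℚ 2),
      π.1.HasInfinityType T → T.IsLAlgebraic → T.IsRegular →
    ∀ (ρ : Literature.NumberTheory.GaloisRepresentations.FramedGaloisRep ℚ (PadicAlgCl p) 2),
      ρ.toGaloisRep.IsIrreducible →
      (∀ᶠ v : IsDedekindDomain.HeightOneSpectrum (NumberField.RingOfIntegers ℚ) in Filter.cofinite,
        ∃ α : Multiset ℂ, π.1.HasSatakeParamAt v α ∧ ρ.IsUnramifiedAt v ∧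
          ρ.HasFrobCharpolyAt v
            (Literature.NumberTheory.Automorphic.arithFrobPolyOfSatake ι v.residueCard 1 α)) →
    ∀ (P : Literature.NumberTheory.Automorphic.CuspidalAutomorphicRepData 2 F hF),
      Literature.NumberTheory.Automorphic.IsWeakBaseChangeLiftAE π.1 P.1 →
    ∀ w : IsDedekindDomain.HeightOneSpectrum (NumberField.RingOfIntegers F),
      (p : NumberField.RingOfIntegers F) ∉ w.asIdeal → (ρ.restrictField F).IsUnramifiedAt w →
      ∃ α : Multiset ℂ, P.1.HasSatakeParamAt w α ∧ (ρ.restrictField F).IsUnramifiedAt w ∧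
        (ρ.restrictField F).HasFrobCharpolyAt w
          (Literature.NumberTheory.Automorphic.arithFrobPolyOfSatake ι w.residueCard 1 α)

/-! ## The stub -/

end Literature.NumberTheory.Automorphic
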